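import Literature.Computability.Complexity.GateEliminationCase54Q13
import Literature.Computability.Complexity.GateEliminationRegate
import Literature.Computability.Complexity.GateEliminationRule4Sharp

/-!
# Gate elimination: Cases 5.4.1.4.2.4/5 of Li–Yang's Theorem 4.1 (the ⊕-type `F`)

"Assume that `F` is an ⊕-type gate and `u` is unprotected. Then we can first substitute an
appropriate constant to `t` to trivialize `E`. This would make `D` a `1`-gate. Now notice that
`F = D ⊕ u ⊕ c₁ = G ⊕ z ⊕ u ⊕ c₂`, so by performing affine substitution `z ← u ⊕ c` for arbitrary
constant `c`, we can make `F = G ⊕ c ⊕ c₂`. Therefore, we can rewire the circuit (i.e. make all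
descendants of `F` fed by `G` directly) such that the gates `D` and `F` are removed, and `z` and
`u` become `0`-variables. In this way, we make `3` variables non-influential by `2`
substitutions." "If `F` is an ⊕-type gate and `u` is protected, then … we can first substitute a
constant to its couple to make `u` unprotected, then apply Case 5.4.1.4.2.4. By this, we use
`3` substitutions to make `4` variables non-influential." (ECCC TR21-023, §4.1, Cases 5.4.1.4.2.4,
5.4.1.4.2.5; the paper's `z`, `u` are our `u`, `u'`.) PROVED here: the core `quad24_core` (the
rewiring is Rule 4 — merging the useless `D` into `F` — followed by a redirection of the readers
of the merged gate, whose function is `G ⊕ const`, to `G`), and `stepGoal_quad23_xor`.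

## References

* J. Li, T. Yang, *3.1n − o(n) circuit lower bounds for explicit functions*, STOC 2022;
  ECCC TR21-023, §2.4, §3.3 (Rule 4), §4.1 (Cases 5.4.1.4.2.4/5), Lemma 3.11.
-/

namespace Literature.Computability.Complexity

open Finset

namespace Semicircuit

variable {n : ℕ} {f : (Fin n → ZMod 2) → Bool} {d : ℕ} {αφ αI αQ : ℝ}

/-- A potential-non-increasing packing after deleting a `0`-gate whose variable wires are
`≤ 2`-variables and whose gate wires do not become `1`-gates. [cite: LiYang2022, §3.3 (Rule 1), Prop. 3.10] -/
theorem exists_packing_removeGate_noNew' (D : Semicircuit n) (k₀ : Fin D.m) {m' : ℕ}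
    (ε : Fin m' ≃ {k : Fin D.m // k ≠ k₀}) (h0 : ∀ k a, D.arg k a ≠ .gate k₀)
    {P : Finset (Fin D.m × Fin D.m)} (hP : D.IsPacking P)
    (hvar : ∀ a v, D.arg k₀ a = .var v → D.fanout (.var v) ≤ 2)
    (hgate : ∀ a g, D.arg k₀ a = .gate g → D.fanout (.gate g) ≠ (univ.filter fun a' : Fin 2 => D.arg k₀ a' = .gate g).card + 1) :
    ∃ P' : Finset (Fin m' × Fin m'), (D.removeGate k₀ ε).IsPacking P' ∧ (D.removeGate k₀ ε).potential P' ≤ D.potential P := by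
  classical
  have hcov : ∀ k, (D.removeGate k₀ ε).Troubled k → ¬ D.Troubled ((ε k : Fin D.m)) →
      k ∈ (∅ : Finset _) ∨ k ∈ (∅ : Finset _) := by
    intro k hT' hT
    exfalso
    obtain ⟨a, ha⟩ := D.causedBy_of_new_troubled_removeGate k₀ ε h0 hT' hT
    cases hka : D.arg k₀ a with
    | const c => rw [hka] at ha; exact not_causedBy_const ha
    | gate g =>
      rw [hka] at ha
      rcases ha with ha | ⟨z, hz, -⟩
      · have hkg : (ε k : Fin D.m) = g := (Node.gate.inj ha).symm
        have h1 := D.fanout_removeGate_add k₀ ε h0 (v := .gate g) (fun h => by cases h; exact h0 k₀ a hka)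
        have h3 := hgate a g hka
        have hskip : (Node.gate g : Node n D.m).skip k₀ ε = .gate k := by
          rw [← hkg]; exact Node.skip_gate_coe k₀ ε k
        rw [hskip] at h1
        have := hT'.2.1
        omega
      · cases hz
    | var v =>
      rw [hka] at ha
      rcases ha with ha | ⟨z, hz, a', ha'⟩
      · cases ha
      · cases hz
        have h1 := D.fanout_removeGate_add k₀ ε h0 (v := .var v) (fun h => by cases h)
        have h2 : 1 ≤ (univ.filter fun a'' : Fin 2 => D.arg k₀ a'' = .var v).card :=
          card_pos.mpr ⟨a, mem_filter.mpr ⟨mem_univ _, hka⟩⟩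
        have h3 := hvar a v hka
        have h4 := hT'.fanout_eq_two ha'
        change (D.removeGate k₀ ε).fanout (.var v) + _ = _ at h1
        omega
  have := exists_packing_transfer' D (D.removeGate k₀ ε) (fun k => (ε k : Fin D.m))
    (fun a b h => ε.injective (Subtype.ext h)) hP
    (fun k k' _ _ _ _ h => D.adjacent_removeGate_of k₀ ε k k' h) ∅ ∅ hcov (Or.inl (by simp)) (Or.inl (by simp))
  simpa using this

/-- The merged function of an ⊕-type `1`-gate into its ⊕-type reader sharing its other input is
the remaining input `⊕` a constant. [folklore] -/
theorem mergeOp_xor_xor (C : Semicircuit n) {G Q : Fin C.m} (aQ aG : Fin 2) {dG dQ : Bool}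
    (hG : ∀ a b, C.op G a b = ((a ^^ b) ^^ dG)) (hQ : ∀ a b, C.op Q a b = ((a ^^ b) ^^ dQ)) (p q : Bool) :
    mergeOp C G Q aQ aG p q = ((if aQ = 0 then p else q) ^^ (dG ^^ dQ)) := by
  unfold mergeOp
  obtain rfl | rfl : aQ = 0 ∨ aQ = 1 := by fin_cases aQ <;> simp
  all_goals obtain rfl | rfl : aG = 0 ∨ aG = 1 := by fin_cases aG <;> simp
  all_goals simp only [if_true, if_false, show (1 : Fin 2) ≠ 0 from by decide, hG, hQ]
  all_goals cases p <;> cases q <;> cases dG <;> cases dQ <;> rfl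

/-- **Under the standing hypotheses the output gate has no reader**: a reader in the xor-part
would put the output in the xor-part (an affine output), and a reader `Y` of the acyclic part
reaches the output, contradicting acyclicity. [cite: LiYang2022, §4.1 (Case 0.2)] -/
theorem not_reads_out_of_standing {C : Semicircuit n} {R : RdqSource n} (hf : IsAffineDisperser f d)
    (hd : 2 * d + 1 ≤ R.dim) (hF : C.Fair) (hC : C.ComputesRestr f R) (hS : C.Standing R)
    {ko : Fin C.m} (hko : C.out = .gate ko) (Y : Fin C.m) (a : Fin 2) : C.arg Y a ≠ .gate ko := by
  intro hY
  have hkoK : ko ∉ C.xorPart := fun h => out_ne_gate_of_mem_xorPart hf hd hF hC h hko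
  by_cases hYK : Y ∈ C.xorPart
  · exact hkoK (C.mem_of_arg_eq Y hYK a ko hY)
  · obtain ⟨k, hk, hpath⟩ := hS.reachesOut Y hYK
    rw [hko] at hk; cases hk
    obtain ⟨ρ, hρ⟩ := C.exists_isRank
    -- ranks do not decrease along `Reads` from a gate of the acyclic part
    have key : ∀ g, Relation.ReflTransGen C.Reads Y g → g ∉ C.xorPart ∧ ρ Y ≤ ρ g := by
      intro g hg
      induction hg with
      | refl => exact ⟨hYK, le_rfl⟩
      | tail _ hbc ih =>
        obtain ⟨a', ha'⟩ := hbc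
        have hcK : _ ∉ C.xorPart := fun h => ih.1 (C.mem_of_arg_eq _ h a' _ ha')
        exact ⟨hcK, ih.2.trans (hρ _ hcK a' _ ha' ih.1).le⟩
    have h1 := (key ko hpath).2
    have h2 := hρ Y hYK a ko hY hkoK
    omega

/-- **Core of Cases 5.4.1.4.2.4/5**: in a fair circuit computing `f` on `R₀`, the ⊕-type `D`
reads the gate `G` (at `aD`) and the free unprotected variable `u`, read only by `D`; the readers
of `D` are the ∧-type `E` (at `aE`, other wire the free unprotected `t`) and the ⊕-type `F`
(at `aF`, other wire the free unprotected `u'`, read only by `F`); `D`, `F` are not the output.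
Then `t := c` (eliminating `E`), `u ← u'`, merging the useless `D` into `F` (Rule 4) and
redirecting the readers of the merged gate (computing `G ⊕ const`) to `G`: `t`, `u`, `u'` leave
the influential set, two substitutions, `μ' ≤ μ(C₀, P₀, R₀) - 3α_I`. [cite: LiYang2022, §4.1 (Case 5.4.1.4.2.4)] -/
theorem quad24_core {C₀ : Semicircuit n} {R₀ : RdqSource n} (hf : IsAffineDisperser f d) (hd₀ : 2 * d + 2 ≤ R₀.dim)
    (hF₀ : C₀.Fair) (hC₀ : C₀.ComputesRestr f R₀) {P₀ : Finset (Fin C₀.m × Fin C₀.m)} (hP₀ : C₀.IsPacking P₀)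
    (hφ : 0 ≤ αφ) (hφ2 : αφ ≤ 1 / 2) (hI : 0 ≤ αI) (αQ : ℝ)
    {G D E F : Fin C₀.m} {u t u' : Fin n} {aD aE aF : Fin 2}
    (hDG : C₀.arg D aD = .gate G) (hDu : C₀.arg D aD.rev = .var u) (hDxor : IsXorOp (C₀.op D)) (hDK : D ∉ C₀.xorPart)
    (hED : C₀.arg E aE = .gate D) (hEt : C₀.arg E aE.rev = .var t) (hEand : IsAndOp (C₀.op E))
    (hFD : C₀.arg F aF = .gate D) (hFu : C₀.arg F aF.rev = .var u') (hFxor : IsXorOp (C₀.op F))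
    (hFE : F ≠ E) (htu : t ≠ u) (hut : u' ≠ t) (huu : u' ≠ u)
    (hreadD : ∀ k a, C₀.arg k a = .gate D → k = E ∨ k = F) (hreadu : ∀ k a, C₀.arg k a = .var u → k = D)
    (hreadu' : ∀ k a, C₀.arg k a = .var u' → k = F)
    (hu : R₀.Free u) (hup : ¬ R₀.Protected u) (ht : R₀.Free t) (htp : ¬ R₀.Protected t) (hu'f : R₀.Free u')
    (hu'p : ¬ R₀.Protected u') (hDout : C₀.out ≠ .gate D) (hFout : C₀.out ≠ .gate F) (hG1 : C₀.fanout (.gate G) = 1) :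
    ∃ (C' : Semicircuit n) (R' : RdqSource n) (P' : Finset (Fin C'.m × Fin C'.m)),
      C'.Fair ∧ C'.ComputesRestr f R' ∧ C'.IsPacking P' ∧ R'.dim + 2 = R₀.dim ∧
      C'.measure αφ αI αQ P' R' ≤ C₀.measure αφ αI αQ P₀ R₀ - 3 * αI := by
  classical
  have hEK : E ∉ C₀.xorPart := C₀.not_mem_xorPart_of_isAndOp hEand
  have hFK : F ∉ C₀.xorPart := fun h => hDK (C₀.mem_of_arg_eq F h aF D hFD)
  have hED' : E ≠ D := fun h => by rw [h] at hED; exact C₀.arg_ne_self_of_not_mem hDK _ hED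
  have hFD' : F ≠ D := fun h => by rw [h] at hFD; exact C₀.arg_ne_self_of_not_mem hDK _ hFD
  have hDG' : D ≠ G := fun h => by rw [← h] at hDG; exact C₀.arg_ne_self_of_not_mem hDK _ hDG
  have hEG : E ≠ G := by
    intro h
    have h1 : C₀.arg D aD = .gate E := by rw [hDG, h]
    -- `D` reads `E` and `E` reads `D`: impossible for the acyclic `E`
    exact not_reads_of_reads hEK ⟨aD, h1⟩ ⟨aE, hED⟩
  have hFG : F ≠ G := by
    intro h
    have h1 : C₀.arg D aD = .gate F := by rw [hDG, h]
    exact not_reads_of_reads hFK ⟨aD, h1⟩ ⟨aF, hFD⟩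
  obtain ⟨ko, hko⟩ := exists_out_eq_gate' hf hF₀ hC₀ (by omega)
  obtain ⟨dD, hdD⟩ := hDxor
  -- step 1: `t := c₁` killing `E`
  obtain ⟨c₁, hc₁⟩ := exists_trivializing hEand aE.rev
  let c₁' : ZMod 2 := finTwoEquiv.symm c₁
  have hc₁' : finTwoEquiv c₁' = c₁ := finTwoEquiv.apply_symm_apply c₁
  let C₁ := C₀.substConst t (finTwoEquiv c₁')
  let R₁ := R₀.assignFree t c₁' ht htp
  have hF₁ : C₁.Fair := hF₀.substConst t _
  have hC₁ : C₁.ComputesRestr f R₁ := hC₀.substConst_assignFree ht htp c₁'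
  have hP₁ : C₁.IsPacking (C₀.substConstPacking t (finTwoEquiv c₁') P₀) := hP₀.substConst
  have hd₁ : 2 * d + 1 ≤ R₁.dim := by have := RdqSource.dim_assignFree (b := c₁') ht htp; change R₁.dim + 1 = R₀.dim at this; omega
  have hvar₁ : ∀ {k : Fin C₀.m} {a : Fin 2} {v : Fin n}, v ≠ t → (C₁.arg k a = .var v ↔ C₀.arg k a = .var v) := by
    intro k a v hvt
    show (C₀.arg k a).substConst t _ = .var v ↔ _
    cases hka : C₀.arg k a with
    | const c => exact ⟨(fun h => by cases h), fun h => by cases h⟩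
    | var i =>
      by_cases hit : i = t
      · rw [hit, Node.substConst_var_self]; exact ⟨(fun h => by cases h), fun h => by cases h; exact absurd rfl hvt⟩
      · rw [Node.substConst_var_of_ne hit]
    | gate g => exact ⟨(fun h => by cases h), fun h => by cases h⟩
  have hgate₁ : ∀ {k : Fin C₀.m} {a : Fin 2} {g : Fin C₀.m}, C₁.arg k a = .gate g ↔ C₀.arg k a = .gate g :=
    fun {k a g} => Node.substConst_eq_gate_iff
  have hEt₁ : C₁.arg E aE.rev = .const c₁ := by
    show (C₀.arg E aE.rev).substConst t _ = _; rw [hEt, Node.substConst_var_self]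
    show Node.const (finTwoEquiv c₁') = Node.const c₁; rw [hc₁']
  have hC₁out : C₁.out = .gate ko := by show C₀.out.substConst t _ = _; rw [hko]; rfl
  have htrivE : C₁.liveFn E aE.rev c₁ false = C₁.liveFn E aE.rev c₁ true := hc₁
  have hout₁E : C₁.out ≠ .gate E := out_ne_of_trivialized hf (by omega) hF₁ hC₁ hEt₁ htrivE
  let E₁ := elimDataWTriv hF₁ hC₁ hP₁ hEt₁ htrivE hout₁E hφ hI αQ
  have hr₁ : ∃ r₁, E₁.repl = .const r₁ := ⟨_, rfl⟩
  obtain ⟨kG₁, hkG₁⟩ := E₁.ι_surj G hEG.symm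
  obtain ⟨kD₁, hkD₁⟩ := E₁.ι_surj D hED'.symm
  obtain ⟨kF₁, hkF₁⟩ := E₁.ι_surj F hFE
  have hD₁G : E₁.C'.arg kD₁ aD = .gate kG₁ := by rw [E₁.arg_eq_gate_iff, hkD₁, hkG₁]; exact Or.inl (hgate₁.mpr hDG)
  have hD₁u : E₁.C'.arg kD₁ aD.rev = .var u := by rw [E₁.arg_eq_var_iff, hkD₁]; exact Or.inl ((hvar₁ htu.symm).mpr hDu)
  have hF₁D : E₁.C'.arg kF₁ aF = .gate kD₁ := by rw [E₁.arg_eq_gate_iff, hkF₁, hkD₁]; exact Or.inl (hgate₁.mpr hFD)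
  have hF₁u : E₁.C'.arg kF₁ aF.rev = .var u' := by rw [E₁.arg_eq_var_iff, hkF₁]; exact Or.inl ((hvar₁ hut).mpr hFu)
  have hopD₁ : E₁.C'.op kD₁ = C₀.op D := by rw [elimDataWTriv_op, hkD₁]
  have hopF₁ : E₁.C'.op kF₁ = C₀.op F := by rw [elimDataWTriv_op, hkF₁]
  have hkDG₁ : kD₁ ≠ kG₁ := fun h => hDG' (by rw [← hkD₁, ← hkG₁, h])
  have hkFG₁ : kF₁ ≠ kG₁ := fun h => hFG (by rw [← hkF₁, ← hkG₁, h])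
  have hkFD₁ : kF₁ ≠ kD₁ := fun h => hFD' (by rw [← hkF₁, ← hkD₁, h])
  have hFK₁ : kF₁ ∉ E₁.C'.xorPart := by
    intro h; apply hFK; rw [← hkF₁]; exact (E₁.mem_xorPart_iff kF₁).mp h
  -- readers in `E₁.C'`
  have hpull₁ : ∀ {k : Fin E₁.C'.m} {a : Fin 2} {v : Fin n}, v ≠ t → (E₁.C'.arg k a = .var v ↔ C₀.arg (E₁.ι k) a = .var v) := by
    intro k a v hvt
    obtain ⟨r₁, hr₁'⟩ := hr₁
    rw [E₁.arg_eq_var_iff, hvar₁ hvt]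
    exact ⟨fun h => h.elim id (fun h' => by rw [hr₁'] at h'; cases h'.2), Or.inl⟩
  have hreadu₁ : ∀ k a, E₁.C'.arg k a = .var u → k = kD₁ := fun k a h =>
    E₁.ι_injective ((hreadu _ a ((hpull₁ htu.symm).mp h)).trans hkD₁.symm)
  have hreadu'₁ : ∀ k a, E₁.C'.arg k a = .var u' → k = kF₁ := fun k a h =>
    E₁.ι_injective ((hreadu' _ a ((hpull₁ hut).mp h)).trans hkF₁.symm)
  have hreadD₁ : ∀ k a, E₁.C'.arg k a = .gate kD₁ → k = kF₁ := by
    intro k a h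
    obtain ⟨r₁, hr₁'⟩ := hr₁
    rw [E₁.arg_eq_gate_iff, hkD₁] at h
    rcases h with h | ⟨-, h⟩
    swap; · rw [hr₁'] at h; cases h
    rw [hgate₁] at h
    rcases hreadD _ a h with h' | h'
    · exact absurd h' (E₁.ι_ne k)
    · exact E₁.ι_injective (h'.trans hkF₁.symm)
  -- step 2: `u ← u'`
  have hu₁ : R₁.Free u := (RdqSource.free_assignFree_iff ht htp u).mpr ⟨hu, htu.symm⟩
  have hup₁ : ¬ R₁.Protected u := fun h => hup ((RdqSource.protected_assignFree_iff ht htp u).mp h)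
  have hu'₁ : R₁.Free u' := (RdqSource.free_assignFree_iff ht htp u').mpr ⟨hu'f, hut⟩
  let Eq : LinEq n := ⟨{u'}, 0⟩
  have hEq : ∀ i ∈ Eq.support, R₁.lin i = none ∧ i ≠ u := by
    intro i hi
    have : i = u' := by simpa [Eq] using hi
    subst this
    exact ⟨hu'₁.1, huu⟩
  let R₂ := R₁.assignLin u Eq hu₁ hup₁ hEq
  have hsol : ∀ v, v ∈ R₂.Sol ↔ v ∈ R₁.Sol ∧ v u = v u' + 0 := by
    intro v
    rw [RdqSource.mem_sol_assignLin_iff]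
    have : Eq.eval v = v u' + 0 := by
      show (0 : ZMod 2) + ∑ i ∈ ({u'} : Finset (Fin n)), v i = _
      rw [sum_singleton, add_comm]
    rw [this]
  have hfree : ∀ i, R₂.Free i ↔ R₁.Free i ∧ i ≠ u := RdqSource.free_assignLin_iff hu₁ hup₁ hEq
  have hdim₂ : R₂.dim + 2 = R₀.dim := by
    have h1 := RdqSource.dim_assignLin hu₁ hup₁ hEq
    have h2 := RdqSource.dim_assignFree (b := c₁') ht htp
    change R₂.dim + 1 = R₁.dim at h1; change R₁.dim + 1 = R₀.dim at h2; omega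
  have hE₁out : ∃ g₁, E₁.C'.out = .gate g₁ := by
    have e1 := E₁.out_eq; rw [if_neg hout₁E, hC₁out] at e1
    cases h1o : E₁.C'.out with
    | const cc => rw [h1o] at e1; change Node.const cc = Node.gate ko at e1; cases e1
    | var i => rw [h1o] at e1; change Node.var i = Node.gate ko at e1; cases e1
    | gate g₁ => exact ⟨g₁, rfl⟩
  have houtu : E₁.C'.out ≠ .var u := by obtain ⟨g₁, hg₁⟩ := hE₁out; rw [hg₁]; exact fun h => by cases h
  let C₂ := E₁.C'.substVar u u' (finTwoEquiv (0 : ZMod 2))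
  have hF₂ : C₂.Fair := E₁.fair.substVar u u' _
  have hC₂ : C₂.ComputesRestr f R₂ := E₁.computes.substVar huu hsol hfree hu'₁ houtu
  have hop₂ : ∀ k, C₂.op k = E₁.C'.op k := by
    intro k; funext p q
    show E₁.C'.op k (p ^^ (finTwoEquiv (0 : ZMod 2) && _)) (q ^^ (finTwoEquiv (0 : ZMod 2) && _)) = _
    rw [show finTwoEquiv (0 : ZMod 2) = false from rfl, Bool.false_and, Bool.false_and, Bool.xor_false, Bool.xor_false]
  have hD₂G : C₂.arg kD₁ aD = .gate kG₁ := by show (E₁.C'.arg kD₁ aD).substVar u u' = _; rw [hD₁G]; rfl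
  have hD₂u : C₂.arg kD₁ aD.rev = .var u' := by
    show (E₁.C'.arg kD₁ aD.rev).substVar u u' = _; rw [hD₁u]; exact Node.substVar_var_self u u'
  have hF₂D : C₂.arg kF₁ aF = .gate kD₁ := by show (E₁.C'.arg kF₁ aF).substVar u u' = _; rw [hF₁D]; rfl
  have hF₂u : C₂.arg kF₁ aF.rev = .var u' := by
    show (E₁.C'.arg kF₁ aF.rev).substVar u u' = _; rw [hF₁u]; exact Node.substVar_var_of_ne huu u'
  have hreadu'₂ : ∀ k a, C₂.arg k a = .var u' → k = kD₁ ∨ k = kF₁ := by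
    intro k a h
    change (E₁.C'.arg k a).substVar u u' = .var u' at h
    rw [Node.substVar_eq_var_target_iff] at h
    rcases h with h | h
    · exact Or.inl (hreadu₁ k a h)
    · exact Or.inr (hreadu'₁ k a h)
  have hreadD₂ : ∀ k a, C₂.arg k a = .gate kD₁ → k = kF₁ := by
    intro k a h
    change (E₁.C'.arg k a).substVar u u' = .gate kD₁ at h
    rw [Node.substVar_eq_gate_iff] at h
    exact hreadD₁ k a h
  have hxorD₂ : ∀ a b, C₂.op kD₁ a b = ((a ^^ b) ^^ dD) := by intro a b; rw [hop₂, hopD₁, hdD]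
  obtain ⟨eF, heF⟩ := hFxor
  have hxorF₂ : ∀ a b, C₂.op kF₁ a b = ((a ^^ b) ^^ eF) := by intro a b; rw [hop₂, hopF₁, heF]
  obtain ⟨P₂, hP₂, hpot₂⟩ := exists_packing_substVar_of_not_and E₁.C' u u' (finTwoEquiv (0 : ZMod 2)) huu E₁.packing
    (fun g a hg hand' => by
      rcases hreadu'₂ g a hg with h | h
      · rw [h] at hand'; exact hand'.not_isXorOp ⟨dD, hxorD₂⟩
      · rw [h] at hand'; exact hand'.not_isXorOp ⟨eF, hxorF₂⟩)
  -- step 3: merge the useless `D` into `F` (Rule 4)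
  have hFK₂ : kF₁ ∉ C₂.xorPart := hFK₁
  have hDK₂ : kD₁ ∉ C₂.xorPart := by
    intro h; apply hDK; rw [← hkD₁]; exact (E₁.mem_xorPart_iff kD₁).mp h
  have h1D : C₂.fanout (.gate kD₁) = 1 := by
    -- the only reader of `D` is `F`, reading it once
    unfold fanout
    rw [Finset.sum_eq_single kF₁]
    · have : (univ.filter fun a : Fin 2 => C₂.arg kF₁ a = .gate kD₁) = {aF} := by
        ext a; simp only [mem_filter, mem_univ, true_and, mem_singleton]
        constructor
        · intro h
          rcases fin2_eq_or_eq_rev aF a with e' | e'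
          · exact e'
          · rw [e', hF₂u] at h; cases h
        · intro h; rw [h]; exact hF₂D
      rw [this, card_singleton]
    · intro k _ hk
      rw [card_eq_zero, filter_eq_empty_iff]
      intro a _ h; exact hk (hreadD₂ k a h)
    · intro h; exact absurd (mem_univ _) h
  have hshare : C₂.arg kF₁ aF.rev = C₂.arg kD₁ (aD.rev) := by rw [hF₂u, hD₂u]
  have hOK : C₂.RegateOK kF₁ (mergeOp C₂ kD₁ kF₁ aF aD.rev) (mergeArgs C₂ kD₁ kF₁ aF aD.rev) := by
    refine ⟨fun h => absurd h hFK₂, fun _ a k hk hkK ρ hρ => ?_⟩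
    unfold mergeArgs at hk
    by_cases ha : a = aF
    · rw [if_pos ha] at hk
      exact (hρ kD₁ hDK₂ _ k hk hkK).trans (hρ kF₁ hFK₂ aF kD₁ hF₂D hDK₂)
    · rw [if_neg ha] at hk
      exact hρ kF₁ hFK₂ a k hk hkK
  have hargs1 : mergeArgs C₂ kD₁ kF₁ aF aD.rev aF = C₂.arg kD₁ aD.rev.rev := if_pos rfl
  have hargs2 : mergeArgs C₂ kD₁ kF₁ aF aD.rev aF.rev = C₂.arg kD₁ aD.rev ∨ ∃ c, mergeArgs C₂ kD₁ kF₁ aF aD.rev aF.rev = .const c := by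
    left; unfold mergeArgs; rw [if_neg (fin2_ne_rev aF).symm, hshare]
  have hcons : ∀ (xx : Fin n → Bool) (w : Fin C₂.m → Bool),
      (C₂.regate kF₁ _ _ hOK).Consistent xx w ↔ C₂.Consistent xx w := by
    intro xx w
    refine C₂.consistent_regate_iff kF₁ _ _ hOK (fun xx w hother => ?_) xx w
    have hG : w kD₁ = C₂.op kD₁ (C₂.nodeVal xx w (C₂.arg kD₁ 0)) (C₂.nodeVal xx w (C₂.arg kD₁ 1)) := hother kD₁ hkFD₁.symm
    suffices h : mergeOp C₂ kD₁ kF₁ aF aD.rev (C₂.nodeVal xx w (mergeArgs C₂ kD₁ kF₁ aF aD.rev 0))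
        (C₂.nodeVal xx w (mergeArgs C₂ kD₁ kF₁ aF aD.rev 1)) =
        C₂.op kF₁ (C₂.nodeVal xx w (C₂.arg kF₁ 0)) (C₂.nodeVal xx w (C₂.arg kF₁ 1)) by
      unfold GateEq; rw [h]
    have hvG : C₂.nodeVal xx w (C₂.arg kF₁ aF) = w kD₁ := by rw [hF₂D]; rfl
    have hshare' := hshare
    unfold mergeOp mergeArgs
    obtain rfl | rfl : aF = 0 ∨ aF = 1 := by fin_cases aF <;> simp
    all_goals obtain h0 | h0 : aD = 0 ∨ aD = 1 := by fin_cases aD <;> simp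
    all_goals subst h0
    all_goals simp only [if_true, if_false, show (1 : Fin 2) ≠ 0 from by decide, show (0 : Fin 2) ≠ 1 from by decide,
      show (0 : Fin 2).rev = 1 from rfl, show (1 : Fin 2).rev = 0 from rfl] at hshare' hvG ⊢
    all_goals rw [hshare', ← hG, ← hvG]
  have hFD₃ : (C₂.regate kF₁ _ _ hOK).Fair := fun xx => by simp only [hcons]; exact hF₂ xx
  have hvars : ∀ (a : Fin 2) (i : Fin n), mergeArgs C₂ kD₁ kF₁ aF aD.rev a = .var i → 1 ≤ C₂.fanout (.var i) := by
    intro a i ha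
    unfold mergeArgs at ha
    by_cases h : a = aF
    · rw [if_pos h, show aD.rev.rev = aD from Fin.rev_rev aD, hD₂G] at ha; cases ha
    · rw [if_neg h] at ha; exact one_le_fanout_of_arg_eq ha
  have hCD₃ : (C₂.regate kF₁ _ _ hOK).ComputesRestr f R₂ := hC₂.regate hcons hvars
  have h0₃ := not_reads_merge _ _ hOK hkFD₁.symm hF₂D h1D hargs1 hargs2
  let ε₃ := (C₂.regate kF₁ _ _ hOK).skipEquiv kD₁
  obtain ⟨P₃, hP₃, hpot₃⟩ := exists_packing_merge _ _ hOK hkFD₁.symm hF₂D hshare h1D hargs1 hargs2 ε₃ hP₂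
  have hout₂D : C₂.out ≠ .gate kD₁ := by
    obtain ⟨g₁, hg₁⟩ := hE₁out
    intro h
    change (E₁.C'.out).substVar u u' = .gate kD₁ at h
    rw [hg₁] at h; change Node.gate g₁ = Node.gate kD₁ at h
    have hg : g₁ = kD₁ := Node.gate.inj h
    have e1 := E₁.out_eq; rw [if_neg hout₁E, hC₁out, hg₁, hg] at e1
    change Node.gate (E₁.ι kD₁) = Node.gate ko at e1
    rw [hkD₁] at e1; cases e1; exact hDout hko
  let C₃ := (C₂.regate kF₁ _ _ hOK).removeGate kD₁ ε₃
  have hF₃ : C₃.Fair := hFD₃.removeGate ε₃ h0₃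
  have hC₃ : C₃.ComputesRestr f R₂ := hCD₃.removeGate ε₃ hFD₃ h0₃ hout₂D
  have hinf₃ : C₃.influential R₂ ⊆ C₂.influential R₂ :=
    influential_merge_subset _ _ hOK hkFD₁.symm hF₂D hshare h1D hargs1 hargs2 ε₃ R₂
  have hm₃ : C₃.m + 1 = C₂.m := (C₂.regate kF₁ _ _ hOK).removeGate_m_add_one kD₁ ε₃
  -- the merged gate `F'` and the image of `G`
  let kF₃ : Fin C₃.m := ε₃.symm ⟨kF₁, hkFD₁⟩
  let kG₃ : Fin C₃.m := ε₃.symm ⟨kG₁, hkDG₁.symm⟩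
  have hεF : (ε₃ kF₃ : Fin C₂.m) = kF₁ := by show ((ε₃ (ε₃.symm ⟨kF₁, hkFD₁⟩)) : Fin C₂.m) = kF₁; rw [Equiv.apply_symm_apply ε₃]
  have hεG : (ε₃ kG₃ : Fin C₂.m) = kG₁ := by show ((ε₃ (ε₃.symm ⟨kG₁, hkDG₁.symm⟩)) : Fin C₂.m) = kG₁; rw [Equiv.apply_symm_apply ε₃]
  have hkFG₃ : kF₃ ≠ kG₃ := by
    intro h; have : (ε₃ kF₃ : Fin C₂.m) = (ε₃ kG₃ : Fin C₂.m) := by rw [h]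
    rw [hεF, hεG] at this; exact hkFG₁ this
  have hopF₃ : C₃.op kF₃ = mergeOp C₂ kD₁ kF₁ aF aD.rev := by
    show (C₂.regate kF₁ _ _ hOK).op (ε₃ kF₃) = _; rw [hεF]; exact C₂.regate_op_self kF₁ _ _ hOK
  have hF₃G : C₃.arg kF₃ aF = .gate kG₃ := by
    show ((C₂.regate kF₁ _ _ hOK).arg (ε₃ kF₃) aF).skip kD₁ ε₃ = _
    rw [hεF, C₂.regate_arg_self kF₁ _ _ hOK, hargs1, show aD.rev.rev = aD from Fin.rev_rev aD, hD₂G]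
    exact Node.skip_gate_of_ne kD₁ ε₃ hkDG₁.symm
  have hF₃u : C₃.arg kF₃ aF.rev = .var u' := by
    show ((C₂.regate kF₁ _ _ hOK).arg (ε₃ kF₃) aF.rev).skip kD₁ ε₃ = _
    rw [hεF, C₂.regate_arg_self kF₁ _ _ hOK]
    unfold mergeArgs; rw [if_neg (fin2_ne_rev aF).symm, hF₂u]; rfl
  have hkey : ∀ p q, C₃.op kF₃ p q = ((if aF = 0 then p else q) ^^ (dD ^^ eF)) := by
    intro p q; rw [hopF₃]; exact mergeOp_xor_xor C₂ aF aD.rev hxorD₂ hxorF₂ p q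
  -- step 4: the merged gate computes `G ⊕ const`: redirect its readers to `G`, then delete it
  have hid : ∀ (xx : Fin n → Bool) (w : Fin C₃.m → Bool),
      C₃.op kF₃ (C₃.nodeVal xx w (C₃.arg kF₃ 0)) (C₃.nodeVal xx w (C₃.arg kF₃ 1)) = (C₃.nodeVal xx w (.gate kG₃) ^^ (dD ^^ eF)) := by
    intro xx w
    rw [hkey]
    rcases fin2_eq_or_eq_rev 0 aF with e0 | e0
    · rw [if_pos e0, show (0 : Fin 2) = aF from e0.symm, hF₃G]
    · have e1 : aF = 1 := by rw [e0]; rfl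
      rw [if_neg (show ¬ aF = 0 by rw [e1]; decide), show (1 : Fin 2) = aF from e1.symm, hF₃G]
  have hvok : C₃.RedirectOK kF₃ (.gate kG₃) := Or.inl ⟨aF, hF₃G⟩
  have hselfF : ∀ a, C₃.arg kF₃ a ≠ .gate kF₃ := by
    intro a h
    rcases fin2_eq_or_eq_rev aF a with e' | e'
    · rw [e', hF₃G] at h; exact hkFG₃ (Node.gate.inj h).symm
    · rw [e', hF₃u] at h; cases h
  let C₄ := C₃.redirect kF₃ (.gate kG₃) (dD ^^ eF) hvok
  have hF₄ : C₄.Fair := hF₃.redirect hselfF hid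
  have hC₄ : C₄.ComputesRestr f R₂ := hC₃.redirect hselfF hid (fun i h => by cases h)
  have hfF₄ : C₄.fanout (.gate kF₃) = 0 := C₃.fanout_redirect_self kF₃ _ _ hvok (fun h => hkFG₃ (Node.gate.inj h).symm)
  have hno₅ : ∀ k a, C₄.arg k a ≠ .gate kF₃ := (fanout_eq_zero_iff _ _).mp hfF₄
  have hout₃F : C₃.out ≠ .gate kF₃ := by
    obtain ⟨g₁, hg₁⟩ := hE₁out
    intro h
    change ((C₂.out : Node n C₂.m)).skip kD₁ ε₃ = .gate kF₃ at h
    rw [Node.skip_eq_gate_iff, hεF] at h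
    change (E₁.C'.out).substVar u u' = .gate kF₁ at h
    rw [hg₁] at h; change Node.gate g₁ = Node.gate kF₁ at h
    have hg : g₁ = kF₁ := Node.gate.inj h
    have e1 := E₁.out_eq; rw [if_neg hout₁E, hC₁out, hg₁, hg] at e1
    change Node.gate (E₁.ι kF₁) = Node.gate ko at e1
    rw [hkF₁] at e1; cases e1; exact hFout hko
  have hout₄F : C₄.out ≠ .gate kF₃ := hout₃F
  let ε₅ := C₄.skipEquiv kF₃
  let C₅ := C₄.removeGate kF₃ ε₅
  have hF₅ : C₅.Fair := hF₄.removeGate ε₅ hno₅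
  have hC₅ : C₅.ComputesRestr f R₂ := hC₄.removeGate ε₅ hF₄ hno₅ hout₄F
  -- wires of `C₃`, `C₄`, `C₅`
  have harg₃ : ∀ (k : Fin C₃.m) a, (ε₃ k : Fin C₂.m) ≠ kF₁ → C₃.arg k a = (C₂.arg (ε₃ k) a).skip kD₁ ε₃ := by
    intro k a hk
    show ((C₂.regate kF₁ _ _ hOK).arg (ε₃ k) a).skip kD₁ ε₃ = _
    rw [C₂.regate_arg_of_ne kF₁ _ _ hOK hk]
  have hreadu'₃ : ∀ k a, C₃.arg k a = .var u' → k = kF₃ := by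
    intro k a h
    by_cases hk : (ε₃ k : Fin C₂.m) = kF₁
    · exact ε₃.injective (Subtype.ext (hk.trans hεF.symm))
    · exfalso
      rw [harg₃ k a hk, Node.skip_eq_var_iff] at h
      rcases hreadu'₂ _ a h with h' | h'
      · exact (ε₃ k).2 h'
      · exact hk h'
  have hreadG₃ : ∀ k a, C₃.arg k a = .gate kG₃ → k = kF₃ := by
    intro k a h
    by_cases hk : (ε₃ k : Fin C₂.m) = kF₁
    · exact ε₃.injective (Subtype.ext (hk.trans hεF.symm))
    · exfalso
      rw [harg₃ k a hk, Node.skip_eq_gate_iff, hεG] at h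
      change (E₁.C'.arg (ε₃ k) a).substVar u u' = .gate kG₁ at h
      rw [Node.substVar_eq_gate_iff, E₁.arg_eq_gate_iff, hkG₁] at h
      rcases h with h | ⟨-, h⟩
      swap; · obtain ⟨r₁, hr₁'⟩ := hr₁; rw [hr₁'] at h; cases h
      rw [hgate₁] at h
      -- readers of `G` in `C₀`: only `D`
      have hk' : E₁.ι (ε₃ k) = D := by
        by_contra hne
        have := two_le_fanout hDG h (fun h' => hne h'.symm); omega
      exact (ε₃ k).2 (E₁.ι_injective (hk'.trans hkD₁.symm))
  have hfG₃ : C₃.fanout (.gate kG₃) = 1 := by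
    unfold fanout
    rw [Finset.sum_eq_single kF₃]
    · have : (univ.filter fun a : Fin 2 => C₃.arg kF₃ a = .gate kG₃) = {aF} := by
        ext a; simp only [mem_filter, mem_univ, true_and, mem_singleton]
        constructor
        · intro h
          rcases fin2_eq_or_eq_rev aF a with e' | e'
          · exact e'
          · rw [e', hF₃u] at h; cases h
        · intro h; rw [h]; exact hF₃G
      rw [this, card_singleton]
    · intro k _ hk
      rw [card_eq_zero, filter_eq_empty_iff]
      intro a _ h; exact hk (hreadG₃ k a h)
    · intro h; exact absurd (mem_univ _) h
  have harg₄ : ∀ (k : Fin C₃.m) a, C₄.arg k a = if C₃.arg k a = .gate kF₃ then Node.gate kG₃ else C₃.arg k a :=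
    fun k a => rfl
  have hargF₄ : ∀ a, C₄.arg kF₃ a = C₃.arg kF₃ a := by intro a; rw [harg₄, if_neg (hselfF a)]
  have hvar₅ : ∀ (k : Fin C₅.m) a v, C₅.arg k a = .var v → C₃.arg (ε₅ k : Fin C₃.m) a = .var v := by
    intro k a v h
    change (C₄.arg (ε₅ k) a).skip kF₃ ε₅ = .var v at h
    rw [Node.skip_eq_var_iff, harg₄] at h
    by_cases hh : C₃.arg (ε₅ k) a = .gate kF₃
    · rw [if_pos hh] at h; cases h
    · rw [if_neg hh] at h; exact h
  have hvar₅' : ∀ (k : Fin C₅.m) a v, C₃.arg (ε₅ k : Fin C₃.m) a = .var v → C₅.arg k a = .var v := by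
    intro k a v h
    show (C₄.arg (ε₅ k) a).skip kF₃ ε₅ = .var v
    rw [harg₄, h, if_neg (fun h' => by cases h')]; rfl
  have hfv₅ : ∀ v, v ≠ u' → C₅.fanout (.var v) = C₃.fanout (.var v) := by
    intro v hvu
    have h1 := C₄.fanout_removeGate_add kF₃ ε₅ hno₅ (v := .var v) (fun h => by cases h)
    have h2 : (univ.filter fun a : Fin 2 => C₄.arg kF₃ a = .var v).card = 0 := by
      rw [card_eq_zero, filter_eq_empty_iff]
      intro a _ h
      rw [hargF₄] at h
      rcases fin2_eq_or_eq_rev aF a with e' | e'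
      · rw [e', hF₃G] at h; cases h
      · rw [e', hF₃u] at h; cases h; exact hvu rfl
    have h3 : C₄.fanout (.var v) = C₃.fanout (.var v) :=
      C₃.fanout_redirect_of_ne kF₃ _ _ hvok (fun h => by cases h) (fun h => by cases h)
    change C₅.fanout (.var v) + _ = _ at h1
    rw [h2, h3] at h1; omega
  have hfu'₅ : C₅.fanout (.var u') = 0 := by
    unfold fanout
    rw [Finset.sum_eq_zero]
    intro k _
    rw [card_eq_zero, filter_eq_empty_iff]
    intro a _ h
    exact (ε₅ k).2 (hreadu'₃ _ a (hvar₅ k a u' h))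
  have hfg₅ : ∀ k : Fin C₅.m, (ε₅ k : Fin C₃.m) ≠ kG₃ → C₅.fanout (.gate k) = C₃.fanout (.gate (ε₅ k : Fin C₃.m)) := by
    intro k hkG
    have h1 := C₄.fanout_removeGate_add kF₃ ε₅ hno₅ (v := .gate (ε₅ k : Fin C₄.m)) (fun h => (ε₅ k).2 (Node.gate.inj h))
    have h2 : (univ.filter fun a : Fin 2 => C₄.arg kF₃ a = .gate (ε₅ k : Fin C₄.m)).card = 0 := by
      rw [card_eq_zero, filter_eq_empty_iff]
      intro a _ h
      rw [hargF₄] at h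
      rcases fin2_eq_or_eq_rev aF a with e' | e'
      · rw [e', hF₃G] at h; exact hkG (Node.gate.inj h).symm
      · rw [e', hF₃u] at h; cases h
    have h3 : C₄.fanout (.gate (ε₅ k : Fin C₄.m)) = C₃.fanout (.gate (ε₅ k : Fin C₃.m)) :=
      C₃.fanout_redirect_of_ne kF₃ _ _ hvok (fun h => (ε₅ k).2 (Node.gate.inj h)) (fun h => hkG (Node.gate.inj h))
    have hskip : (Node.gate (ε₅ k : Fin C₄.m) : Node n C₄.m).skip kF₃ ε₅ = .gate k := Node.skip_gate_coe kF₃ ε₅ k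
    rw [hskip, h2, h3] at h1
    change C₅.fanout (.gate k) + 0 = _ at h1
    omega
  have hfG₅ : ∀ k : Fin C₅.m, (ε₅ k : Fin C₃.m) = kG₃ → C₅.fanout (.gate k) + 1 = 1 + C₃.fanout (.gate kF₃) := by
    intro k hkG
    have h1 := C₄.fanout_removeGate_add kF₃ ε₅ hno₅ (v := .gate (ε₅ k : Fin C₄.m)) (fun h => (ε₅ k).2 (Node.gate.inj h))
    have h2 : (univ.filter fun a : Fin 2 => C₄.arg kF₃ a = .gate (ε₅ k : Fin C₄.m)).card = 1 := by
      have : (univ.filter fun a : Fin 2 => C₄.arg kF₃ a = .gate (ε₅ k : Fin C₄.m)) = {aF} := by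
        ext a; simp only [mem_filter, mem_univ, true_and, mem_singleton]
        rw [hargF₄]
        constructor
        · intro h
          rcases fin2_eq_or_eq_rev aF a with e' | e'
          · exact e'
          · rw [e', hF₃u] at h; cases h
        · intro h; rw [h, hF₃G]; exact congrArg Node.gate hkG.symm
      rw [this, card_singleton]
    have h3 : C₄.fanout (.gate (ε₅ k : Fin C₄.m)) = C₃.fanout (.gate kG₃) + C₃.fanout (.gate kF₃) := by
      have := C₃.fanout_redirect_target kF₃ (.gate kG₃) (dD ^^ eF) hvok (fun h => hkFG₃ (Node.gate.inj h).symm)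
      rw [show (Node.gate (ε₅ k : Fin C₄.m) : Node n C₄.m) = .gate kG₃ from congrArg Node.gate hkG]
      exact this
    have hskip : (Node.gate (ε₅ k : Fin C₄.m) : Node n C₄.m).skip kF₃ ε₅ = .gate k := Node.skip_gate_coe kF₃ ε₅ k
    rw [hskip, h2, h3, hfG₃] at h1
    exact h1
  have hop₅ : ∀ k : Fin C₅.m, (∀ a, C₃.arg (ε₅ k : Fin C₃.m) a ≠ .gate kF₃) → C₅.op k = C₃.op (ε₅ k : Fin C₃.m) := by
    intro k hk
    funext p q
    show C₃.op (ε₅ k : Fin C₃.m) (p ^^ ((dD ^^ eF) && decide (C₃.arg (ε₅ k : Fin C₃.m) 0 = .gate kF₃)))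
      (q ^^ ((dD ^^ eF) && decide (C₃.arg (ε₅ k : Fin C₃.m) 1 = .gate kF₃))) = _
    rw [decide_eq_false (hk 0), decide_eq_false (hk 1), Bool.and_false, Bool.xor_false, Bool.xor_false]
  -- no new troubled gate
  have hcov : ∀ k, C₅.Troubled k → ¬ C₃.Troubled (ε₅ k : Fin C₃.m) → k ∈ (∅ : Finset _) ∨ k ∈ (∅ : Finset _) := by
    intro k hT' hT
    exfalso; apply hT
    obtain ⟨hand', hf1, v₁, v₂, hne, hrange, hv₁, hv₂⟩ := hT'
    have hwires : ∀ a, ∃ v, C₅.arg k a = .var v ∧ (v = v₁ ∨ v = v₂) := by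
      intro a
      have : C₅.arg k a ∈ Set.range (C₅.arg k) := ⟨a, rfl⟩
      rw [hrange] at this
      rcases this with h | h
      · exact ⟨v₁, h, Or.inl rfl⟩
      · exact ⟨v₂, h, Or.inr rfl⟩
    have hnotF : ∀ a, C₃.arg (ε₅ k : Fin C₃.m) a ≠ .gate kF₃ := by
      intro a h
      obtain ⟨v, hv, -⟩ := hwires a
      rw [hvar₅ k a v hv] at h; cases h
    have hv₁u : v₁ ≠ u' := by intro h; rw [h, hfu'₅] at hv₁; cases hv₁
    have hv₂u : v₂ ≠ u' := by intro h; rw [h, hfu'₅] at hv₂; cases hv₂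
    have hrange₃ : Set.range (C₃.arg (ε₅ k : Fin C₃.m)) = {Node.var v₁, Node.var v₂} := by
      ext nd
      constructor
      · rintro ⟨a, rfl⟩
        obtain ⟨v, hv, hv'⟩ := hwires a
        rw [hvar₅ k a v hv]
        rcases hv' with rfl | rfl
        · exact Or.inl rfl
        · exact Or.inr rfl
      · intro hm
        rcases hm with hm | hm
        · obtain ⟨a, ha⟩ : (Node.var v₁ : Node n C₅.m) ∈ Set.range (C₅.arg k) := by rw [hrange]; exact Or.inl rfl
          exact ⟨a, by rw [hm]; exact hvar₅ k a v₁ ha⟩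
        · obtain ⟨a, ha⟩ : (Node.var v₂ : Node n C₅.m) ∈ Set.range (C₅.arg k) := by rw [hrange]; exact Or.inr rfl
          exact ⟨a, by rw [hm]; exact hvar₅ k a v₂ ha⟩
    have hand₃ : IsAndOp (C₃.op (ε₅ k : Fin C₃.m)) := by rw [← hop₅ k hnotF]; exact hand'
    refine ⟨hand₃, ?_, v₁, v₂, hne, hrange₃, by rw [← hfv₅ v₁ hv₁u]; exact hv₁, by rw [← hfv₅ v₂ hv₂u]; exact hv₂⟩
    by_cases hkG : (ε₅ k : Fin C₃.m) = kG₃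
    · rw [hkG]; exact hfG₃
    · rw [← hfg₅ k hkG]; exact hf1
  have hadj : ∀ k k', C₅.Troubled k → C₅.Troubled k' → C₃.Troubled (ε₅ k : Fin C₃.m) → C₃.Troubled (ε₅ k' : Fin C₃.m) →
      C₃.Adjacent (ε₅ k : Fin C₃.m) (ε₅ k' : Fin C₃.m) → C₅.Adjacent k k' := by
    intro k k' _ _ _ _ hadj'
    obtain ⟨z, ⟨a, ha⟩, ⟨a', ha'⟩⟩ := hadj'
    exact ⟨z, ⟨a, hvar₅' k a z ha⟩, ⟨a', hvar₅' k' a' z ha'⟩⟩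
  obtain ⟨P₅, hP₅, hpot₅⟩ := exists_packing_transfer' C₃ C₅ (fun k => (ε₅ k : Fin C₃.m))
    (fun a b h => ε₅.injective (Subtype.ext h)) hP₃ hadj ∅ ∅ hcov (Or.inl (by simp)) (Or.inl (by simp))
  simp only [if_true, Nat.cast_zero, add_zero] at hpot₅
  -- `u'` is unprotected in `R₂`
  have hu'p₂ : ¬ R₂.Protected u' := fun h =>
    hu'p ((RdqSource.protected_assignFree_iff ht htp u').mp ((RdqSource.protected_assignLin_iff hu₁ hup₁ hEq u').mp h))
  -- accounting
  have htinf : t ∈ C₀.influential R₀ := C₀.mem_influential_of_reads R₀ hEt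
  have hμ₁ := measure_substConst_le hφ αI αQ hP₀ R₀ R₁ t (finTwoEquiv c₁')
  have hinf₁ : (1 : ℝ) ≤ ((C₀.influential R₀).card : ℝ) - (C₁.influential R₁).card := by
    have h1 : (C₁.influential R₁).card ≤ ((C₀.influential R₀).erase t).card :=
      card_le_card (C₀.influential_substConst_assignFree_subset ht htp c₁' (finTwoEquiv c₁'))
    have h3 := card_erase_add_one htinf
    have : (C₁.influential R₁).card + 1 ≤ (C₀.influential R₀).card := by omega
    have : ((C₁.influential R₁).card : ℝ) + 1 ≤ (C₀.influential R₀).card := by exact_mod_cast this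
    linarith
  have hq₁ : ((R₀.quadCount : ℝ) - (R₁.quadCount : ℝ)) = 0 := by
    have : R₁.quadCount = R₀.quadCount := RdqSource.quadCount_assignFree ht htp; rw [this]; ring
  have hμE₁ := E₁.measure_le
  have huinf₁ : u ∈ E₁.C'.influential R₁ := E₁.C'.mem_influential_of_reads R₁ hD₁u
  have hu'inf₁ : u' ∈ E₁.C'.influential R₁ := E₁.C'.mem_influential_of_reads R₁ hF₁u
  have hinf₂ : ((C₂.influential R₂).card : ℝ) + 1 ≤ (E₁.C'.influential R₁).card := by
    have hfreej : ¬ R₂.Free u := fun h => ((hfree u).mp h).2 rfl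
    have hprot : ∀ i, R₂.Protected i → R₁.Protected i := fun i h => (RdqSource.protected_assignLin_iff hu₁ hup₁ hEq i).mp h
    have h1 := E₁.C'.influential_substVar_subset u u' (finTwoEquiv (0 : ZMod 2)) huu hfreej hprot
    have h2 : insert u' ((E₁.C'.influential R₁).erase u) = (E₁.C'.influential R₁).erase u :=
      insert_eq_of_mem (mem_erase.mpr ⟨huu, hu'inf₁⟩)
    rw [h2] at h1
    have h3 := card_le_card h1
    change (C₂.influential R₂).card ≤ _ at h3
    have h4 := card_erase_add_one huinf₁
    have : (C₂.influential R₂).card + 1 ≤ (E₁.C'.influential R₁).card := by omega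
    exact_mod_cast this
  have hq₂ : (R₂.quadCount : ℝ) = R₁.quadCount := rfl
  have hpot₂' : (C₂.potential P₂ : ℝ) ≤ E₁.C'.potential E₁.P' := by exact_mod_cast hpot₂
  have hμ₂ : C₂.measure αφ αI αQ P₂ R₂ ≤ E₁.C'.measure αφ αI αQ E₁.P' R₁ - αI := by
    unfold measure
    rw [hq₂]
    show ((E₁.C'.m : ℕ) : ℝ) + _ + _ + _ ≤ _
    nlinarith [mul_le_mul_of_nonneg_left hinf₂ hI, mul_le_mul_of_nonneg_left hpot₂' hφ]
  have hinf₃' : ((C₃.influential R₂).card : ℝ) ≤ (C₂.influential R₂).card := by exact_mod_cast card_le_card hinf₃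
  have hm₃' : (C₃.m : ℝ) + 1 = C₂.m := by exact_mod_cast hm₃
  have hμ₃ : C₃.measure αφ αI αQ P₃ R₂ ≤ C₂.measure αφ αI αQ P₂ R₂ := by
    unfold measure
    nlinarith [mul_le_mul_of_nonneg_left hinf₃' hI, mul_le_mul_of_nonneg_left hpot₃ hφ, hφ2]
  have hu'inf₃ : u' ∈ C₃.influential R₂ := C₃.mem_influential_of_reads R₂ hF₃u
  have hinf₅ : ((C₅.influential R₂).card : ℝ) + 1 ≤ (C₃.influential R₂).card := by
    have hsub : C₅.influential R₂ ⊆ (C₃.influential R₂).erase u' := by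
      intro i hi
      unfold influential at hi ⊢
      rw [mem_filter] at hi
      rw [mem_erase, mem_filter]
      rcases hi.2 with h | h
      · have hiu : i ≠ u' := by intro e; rw [e, hfu'₅] at h; omega
        exact ⟨hiu, mem_univ _, Or.inl (by rw [← hfv₅ i hiu]; exact h)⟩
      · exact ⟨fun e => hu'p₂ (e ▸ h), mem_univ _, Or.inr h⟩
    have h1 := card_le_card hsub
    have h2 := card_erase_add_one hu'inf₃
    have : (C₅.influential R₂).card + 1 ≤ (C₃.influential R₂).card := by omega
    exact_mod_cast this
  have hm₅ : (C₅.m : ℝ) + 1 = C₃.m := by exact_mod_cast C₄.removeGate_m_add_one kF₃ ε₅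
  have hμ₅ : C₅.measure αφ αI αQ P₅ R₂ ≤ C₃.measure αφ αI αQ P₃ R₂ - 1 - αI := by
    unfold measure
    nlinarith [mul_le_mul_of_nonneg_left hinf₅ hI, mul_le_mul_of_nonneg_left hpot₅ hφ]
  refine ⟨C₅, R₂, P₅, hF₅, hC₅, hP₅, hdim₂, ?_⟩
  rw [hq₁] at hμ₁
  have hαI₁ := mul_le_mul_of_nonneg_left hinf₁ hI
  linarith [hμ₁, hμE₁, hμ₂, hμ₃, hμ₅, hαI₁]

variable {C : Semicircuit n} {R : RdqSource n} {G : Fin C.m} {x y : Fin n} {B C' D : Fin C.m} {aX aB aC aD : Fin 2}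

/-- **Cases 5.4.1.4.2.4/5 of the proof of Thm. 4.1** (the ⊕-type part of hypothesis `hQ23` of
`stepGoal_quadratic_aux` with `u' ≠ y`): the other reader `F` of `D` is an ⊕-type `2`-gate reading
the `1`-variable `u' ≠ t`. If `u'` is unprotected: `quad24_core` (`3α_I ≥ 2δ`); if protected:
first a constant to its couple, then the core (`4α_I ≥ 3δ`). [cite: LiYang2022, §4.1 (Cases 5.4.1.4.2.4/5)] -/
theorem stepGoal_quad23_xor (hf : IsAffineDisperser f d) (hd : 2 * d + 2 < R.dim) (hF : C.Fair)
    (hC : C.ComputesRestr f R) (hS : C.Standing R) (hcfg : C.Case5Config G x y B C' D aX aB aC aD)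
    (hφ0 : 0 < αφ) (hφ : αφ < 1 / 2) (hI0 : 0 < αI) (hQ0 : 0 < αQ)
    {E : Fin C.m} {aE : Fin 2} {u : Fin n} (hDn : ¬ IsAndOp (C.op D)) (hIu : C.arg D aD.rev = .var u)
    (hup : ¬ R.Protected u) (hu1 : C.fanout (.var u) = 1) (hD2 : C.fanout (.gate D) = 2)
    (hEand : IsAndOp (C.op E)) (hED : C.arg E aE = .gate D)
    {t : Fin n} {F : Fin C.m} {aF : Fin 2} {u' : Fin n} (hEt : C.arg E aE.rev = .var t) (hFE : F ≠ E)
    (hFD : C.arg F aF = .gate D) (hFu : C.arg F aF.rev = .var u') (hut : u' ≠ t) (hF2 : C.fanout (.gate F) = 2)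
    (hu'1 : C.fanout (.var u') = 1) (hFn : ¬ IsAndOp (C.op F)) :
    C.StepGoal f R αφ αI αQ := by
  classical
  have hφ' := hφ0.le
  have hI' := hI0.le
  have hGK := hcfg.G_not_mem
  have hDK : D ∉ C.xorPart := fun hDK => hGK (C.mem_of_arg_eq D hDK aD G hcfg.arg_D)
  have hEK : E ∉ C.xorPart := C.not_mem_xorPart_of_isAndOp hEand
  have hDxor : IsXorOp (C.op D) := C.isXorOp_of_isAffineOp hS.nonDegenerate ((isAndOp_or_isAffineOp _).resolve_left hDn)
  have hFxor : IsXorOp (C.op F) := C.isXorOp_of_isAffineOp hS.nonDegenerate ((isAndOp_or_isAffineOp _).resolve_left hFn)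
  have hED' : E ≠ D := fun h => by rw [h] at hED; exact C.arg_ne_self_of_not_mem hDK _ hED
  have hFD' : F ≠ D := fun h => by rw [h] at hFD; exact C.arg_ne_self_of_not_mem hDK _ hFD
  have htu : t ≠ u := by intro h; rw [h] at hEt; have := two_le_fanout hIu hEt hED'.symm; omega
  have huu : u' ≠ u := by intro h; rw [h] at hFu; have := two_le_fanout hIu hFu hFD'.symm; omega
  have hreadD : ∀ k a, C.arg k a = .gate D → k = E ∨ k = F := by
    intro k a h
    by_contra hno; rw [not_or] at hno
    have := three_le_fanout hED hFD h hFE.symm (fun h' => hno.1 h'.symm) (fun h' => hno.2 h'.symm); omega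
  have hreadu : ∀ k a, C.arg k a = .var u → k = D := by
    intro k a h; by_contra hk; have := two_le_fanout hIu h (fun h' => hk h'.symm); omega
  have hreadu' : ∀ k a, C.arg k a = .var u' → k = F := by
    intro k a h; by_contra hk; have := two_le_fanout hFu h (fun h' => hk h'.symm); omega
  have hu : R.Free u := free_of_reads hC hIu
  have ht : R.Free t := free_of_reads hC hEt
  have htp : ¬ R.Protected t := fun h => hS.protected_not_and t h E aE.rev hEt hEand
  have hu'f : R.Free u' := free_of_reads hC hFu
  have hDout : C.out ≠ .gate D := out_ne_of_read_bYacyclic hS hEK ⟨aE, hED⟩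
  obtain ⟨ko, hko⟩ := exists_out_eq_gate' hf hF hC (by omega)
  have hFout : C.out ≠ .gate F := by
    intro h
    have hkF : ko = F := by rw [h] at hko; exact (Node.gate.inj hko).symm
    -- `F` has readers, the output has none
    have h0 : C.fanout (.gate F) = 0 := by
      rw [← hkF]; exact (fanout_eq_zero_iff _ _).mpr (not_reads_out_of_standing hf (by omega) hF hC hS hko)
    omega
  by_cases hu'p : R.Protected u'
  swap
  · obtain ⟨C', R', P', hF', hC', hP', hdim', hμ'⟩ := quad24_core hf (by omega) hF hC C.isPacking_empty hφ' (by linarith) hI' αQ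
      hcfg.arg_D hIu hDxor hDK hED hEt hEand hFD hFu hFxor hFE htu hut huu hreadD hreadu hreadu' hu hup ht htp hu'f hu'p
      hDout hFout hcfg.fanout_G
    refine Or.inr ⟨2, by norm_num, by norm_num, C', R', P', hF', hC', hP', hdim', ?_⟩
    have hδ := two_liYangDelta_le_three αφ hI' αQ
    push_cast
    linarith
  · -- Case 5.4.1.4.2.5: first a constant to the couple `w` of `u'`
    obtain ⟨-, l, e, he, hru⟩ := hu'p
    obtain ⟨⟨-, -⟩, ⟨-, -⟩, hik⟩ := R.quad_wf l e he
    let w : Fin n := if e.i = u' then e.k else e.i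
    have hrw : e.Reads w := by
      show e.i = w ∨ e.k = w
      by_cases h : e.i = u'
      · right; simp [w, h]
      · left; simp [w, h]
    have hwu' : w ≠ u' := by
      intro h'
      by_cases h : e.i = u'
      · have : e.k = u' := by simp only [w, if_pos h] at h'; exact h'
        exact hik (h.trans this.symm)
      · have : e.i = u' := by simp only [w, if_neg h] at h'; exact h'
        exact h this
    have hru' : e.Reads u' := hru
    have hwprot : R.Protected w := by
      refine ⟨?_, l, e, he, hrw⟩
      rcases hrw with h | h
      · rw [← h]; exact ⟨(R.quad_wf l e he).1.1, (R.quad_wf l e he).1.2⟩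
      · rw [← h]; exact ⟨(R.quad_wf l e he).2.1.1, (R.quad_wf l e he).2.1.2⟩
    have hwu : w ≠ u := fun h => hup (h ▸ hwprot)
    have hwt : w ≠ t := fun h => htp (h ▸ hwprot)
    let C₀ := C.substConst w (finTwoEquiv (0 : ZMod 2))
    let R₀ := R.assignProtected he hrw 0
    have hF₀ : C₀.Fair := hF.substConst w _
    have hC₀ : C₀.ComputesRestr f R₀ := hC.substConst_assignProtected he hrw 0
    have hP₀ : C₀.IsPacking (C.substConstPacking w (finTwoEquiv (0 : ZMod 2)) ∅) := C.isPacking_empty.substConst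
    have hdim₀ : R₀.dim + 1 = R.dim := RdqSource.dim_assignProtected he hrw 0
    have hvar₀ : ∀ {k : Fin C.m} {a : Fin 2} {v : Fin n}, v ≠ w → (C₀.arg k a = .var v ↔ C.arg k a = .var v) := by
      intro k a v hvw
      show (C.arg k a).substConst w _ = .var v ↔ _
      cases hka : C.arg k a with
      | const c => exact ⟨(fun h => by cases h), fun h => by cases h⟩
      | var i =>
        by_cases hiw : i = w
        · rw [hiw, Node.substConst_var_self]; exact ⟨(fun h => by cases h), fun h => by cases h; exact absurd rfl hvw⟩
        · rw [Node.substConst_var_of_ne hiw]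
      | gate g => exact ⟨(fun h => by cases h), fun h => by cases h⟩
    have hgate₀ : ∀ {k : Fin C.m} {a : Fin 2} {g : Fin C.m}, C₀.arg k a = .gate g ↔ C.arg k a = .gate g :=
      fun {k a g} => Node.substConst_eq_gate_iff
    have hfree₀ : ∀ i, R₀.Free i ↔ R.Free i ∧ i ≠ w := fun i => RdqSource.free_assignProtected_iff he hrw 0 i
    have hprot₀ : ∀ i, R₀.Protected i → R.Protected i := fun i h => RdqSource.protected_of_protected_assignProtected he hrw 0 h
    have hu'p₀ : ¬ R₀.Protected u' := RdqSource.not_protected_assignProtected_of_reads he hrw 0 hru'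
    have hout₀ : C₀.out = .gate ko := by show C.out.substConst w _ = _; rw [hko]; rfl
    obtain ⟨C', R', P', hF', hC', hP', hdim', hμ'⟩ := quad24_core (C₀ := C₀) (R₀ := R₀) hf (by omega) hF₀ hC₀ hP₀ hφ'
      (by linarith) hI' αQ (G := G) (D := D) (E := E) (F := F) (u := u) (t := t) (u' := u') (aD := aD) (aE := aE) (aF := aF)
      (hgate₀.mpr hcfg.arg_D) ((hvar₀ hwu.symm).mpr hIu) hDxor hDK (hgate₀.mpr hED) ((hvar₀ hwt.symm).mpr hEt) hEand
      (hgate₀.mpr hFD) ((hvar₀ hwu'.symm).mpr hFu) hFxor hFE htu hut huu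
      (fun k a h => hreadD k a (hgate₀.mp h)) (fun k a h => hreadu k a ((hvar₀ hwu.symm).mp h))
      (fun k a h => hreadu' k a ((hvar₀ hwu'.symm).mp h))
      ((hfree₀ u).mpr ⟨hu, hwu.symm⟩) (fun h => hup (hprot₀ u h)) ((hfree₀ t).mpr ⟨ht, hwt.symm⟩) (fun h => htp (hprot₀ t h))
      ((hfree₀ u').mpr ⟨hu'f, hwu'.symm⟩) hu'p₀
      (by rw [hout₀]; exact fun h => hDout (by rw [hko]; exact h)) (by rw [hout₀]; exact fun h => hFout (by rw [hko]; exact h))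
      (by rw [C.fanout_substConst_gate]; exact hcfg.fanout_G)
    refine Or.inr ⟨3, by norm_num, le_rfl, C', R', P', hF', hC', hP', by omega, ?_⟩
    have hwinf : w ∈ C.influential R := by
      unfold influential; rw [mem_filter]; exact ⟨mem_univ _, Or.inr hwprot⟩
    have hμ₀ := measure_substConst_le hφ' αI αQ C.isPacking_empty R R₀ w (finTwoEquiv (0 : ZMod 2))
    have hinf₀ : (1 : ℝ) ≤ ((C.influential R).card : ℝ) - (C₀.influential R₀).card := by
      have h1 : (C₀.influential R₀).card ≤ ((C.influential R).erase w).card :=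
        card_le_card ((C.influential_substConst_assignProtected_subset he hrw 0 (finTwoEquiv (0 : ZMod 2))).trans (filter_subset _ _))
      have h3 := card_erase_add_one hwinf
      have : (C₀.influential R₀).card + 1 ≤ (C.influential R).card := by omega
      have : ((C₀.influential R₀).card : ℝ) + 1 ≤ (C.influential R).card := by exact_mod_cast this
      linarith
    have hq₀ : ((R.quadCount : ℝ) - (R₀.quadCount : ℝ)) = 1 := by
      have : R₀.quadCount + 1 = R.quadCount := RdqSource.quadCount_assignProtected he hrw 0
      have : ((R₀.quadCount : ℝ)) + 1 = R.quadCount := by exact_mod_cast this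
      linarith
    have hδ := three_liYangDelta_le_four αφ αI αQ
    rw [hq₀] at hμ₀
    have hαI := mul_le_mul_of_nonneg_left hinf₀ hI'
    push_cast
    nlinarith [hμ₀, hμ', hαI, hQ0.le]

end Semicircuit

end Literature.Computability.Complexity
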